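import Summits.QuantumFields.BalabanUV.Beta.D1BFx.CornerJRankOne
import Summits.QuantumFields.BalabanUV.Beta.D1BFx.ProjectorSupNorm
import Summits.QuantumFields.BalabanUV.Beta.D1BFx.RdotBlockRange

/-!
# `BalabanUV.Beta.D1BFx.NeedleRowLetters` — road «BF-x» for binder row D1, slot (REST′), rows A3.a′∕A3.b′: THE n-FREE LETTER OF THE NEEDLE ROW —
# block regrouping of lattice sums, an `n`-free sup bound for the rows of `R∘G′ = Ggh − Pgt∘Ggh` on the road (sharp projector bound × the uniform
# bound of the tower propagator), hence `|row(x)| ≤ c(a)·n^{κ′−3}` with `c(a)` independent of the block side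

HONEST DEPENDENCY (page 1, mandatory): continuum YM on T⁴ ⇐ BetaPertH ∧ nine spine estimates (0/9 proved); BetaPertH ⇐ (D1) ∧ (D4) ∧
CAP+tail; G-an2-4 gates asym, D1 and NE2/3/4.  HONEST FRAMING (cell contract, verbatim): «discharging `BetaPertH` makes Bałaban's UV
stability UNCONDITIONAL — a real constructive-QFT result; it is NOT the continuum limit and NOT the Clay problem.»  THIS MODULE DISCHARGES
NOTHING of the wall: [folklore] lattice bookkeeping (`HasSum.prod_fiberwise` through pv23's block chart `B6QGQLower276.chart∕blk∕locFin`) over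
leaf-07-g3's `ProjectorSupNorm.abs_Pgt_le_sup` (the SHARP `n⁻⁴` projector bound), the typer's `GhostLeg.abs_Ggh_le`, leaf-09-g2's
`RProjector.abs_tsum_le_latticeConst`, this lineage's `RdotBlockRange.summable_Pgt_mul_Ggh` (g5) and `CornerJRankOne.abs_row_le` (g6) BY NAME; no `def`,
no `def … : Prop`, nothing cited, 0 sorry.  0 wall binders; NOT the (REST′) word bounds, NOT (K), NOT D1, NOT `BetaPertH`, NOT continuum, NOT Clay.

LITERAL NOTE (row-D1 owner R-D1-g25-1 ∕ road owner ρ-g7-2 (d), 2026-08-21): these are the COMB-TERM (`σ = id`) needles; for the permutation-symmetrised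
literal of record `JsB12Sym` the first-order averaging jet is the `S_D`-mean of the `D!` permuted needles (linear), so every identity below applies
summand by summand.

ABSOLUTE RULE (cell charter, verbatim): «No internally-minted statement may enter as a cited fact. Every hypothesis is either kernel-proved in
this package or a verbatim quotation of a PUBLISHED theorem with page reference. The manuscript(s) under audit are NOT citable for their own
disputed steps — they are the thing under adjudication; programme-internal (2001/route/tribunal) claims are never citable.»

WHY.  `CornerJRankOne.abs_row_le` bounds the needle row `row(x) = Σ_{s∈B(blk u)} (R∘G′)(x,s)·qJet n κ′ u (blk u) s` by `M·n^{κ′+1}·n⁻⁴` for ANY sup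
bound `M` of the row `(R∘G′)(x,·)` on the block.  On the road `R∘G′ = Ggh − Pgt∘Ggh`; `|Ggh| ≤ 2/min(2,a)` uniformly (B4 Sect. 5), and
`|(Pgt∘Ggh)(x,s)| ≤ Σ_z |Pgt(x,z)|·|Ggh(z,s)| ≤ (2/min(2,a))·Σ_y Σ_{z∈B(y)} cPPs·n⁻⁴·e^{−δ_PP|blk x − y|} = (2/min(2,a))·cPPs·Σ_y e^{−δ_PP|blk x − y|}`
— the block volume `n⁴` is paid EXACTLY by the sharp projector bound, so `M` is `n`-FREE.  The only non-bookkeeping step is the regrouping of an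
absolutely convergent lattice sum over `ℤ⁴` into its blocks, done once (§1) through the chart equivalence `ℤ⁴ ≃ ℤ⁴ × {0,…,n−1}⁴`.

CONTENT (all [folklore]; B6 index `m`, blocks of side `m+1`; road: `m = n−1`, `0 < a`):
* §1 **`hasSum_blocks`** (`HasSum h a ⟹ HasSum (y ↦ Σ_{z∈B(y)} h z) a`), `tsum_eq_tsum_blocks`.
* §2 `abs_sum_B_Pgt_mul_Ggh_le` (one block: `≤ cPPs·(2/min(2,a))·e^{−δ_PP·dist(blk x, y)}`), **`abs_comp_Pgt_Ggh_le`** (`|(Pgt∘Ggh)(x,s)| ≤ cPPs·(2/min(2,a))·K₄(δ_PP)`),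
  **`abs_RG_road_le`** (`|(R∘G′)(x,s)| ≤ 2/min(2,a) + cPPs·(2/min(2,a))·K₄(δ_PP)` — n-FREE).
* §3 **`abs_needleRow_road_le`**: `|Σ_{s∈B(blk u)} (R∘G′)(x,s)·qJet n κ′ u (blk u) s| ≤ (2/min(2,a) + cPPs·(2/min(2,a))·K₄(δ_PP))·n^{κ′+1}·n⁻⁴`, and the first-difference
  letter `abs_needleRow_diff_road_le` (twice that) for the `dSw` entries of `SbRblkAnatomy`.
Provenance: D1 formalisation swarm, unit b2b-balaban-beta-d1-formalise-leaf-04 gen 6 (prover-b2b-balaban-beta-d1-formalise-leaf-04-g6-0), 2026-08-21;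
sub-leaf «D1-BFx-A3a′-NEEDLE» of `LEAVES-BFx.md` (FILE 6).
-/

namespace Summit.QuantumFields.BalabanUV.Beta.D1BFx.NeedleRowLetters

open Finset
open scoped BigOperators
open Literature.MathematicalPhysics.QuantumFieldTheory.Balaban1983to89
open Literature.MathematicalPhysics.QuantumFieldTheory.Balaban1983to89.Beta
open B4Sect5Proof (latticeConst latticeConst_nonneg)
open B6QGQLower276 (X blk B mem_B chart locFin blk_chart locFin_chart chart_blk_locFin sum_B sum_B_const)
open ExpKernelCalculus (Site MKer comp)
open RProjector (Pgt abs_tsum_le_latticeConst deltaPP deltaPP_pos)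
open ProjectorSupNorm (cPPs cPPs_nonneg abs_Pgt_le_sup)
open GhostLeg (Ggh abs_Ggh_le const_nonneg cast_pred_add_one)
open GhostStencil (qJet)
open RProjectorJet (RG)
open RdotBlockRange (summable_Pgt_mul_Ggh)
open CornerJRankOne (abs_row_le)

noncomputable section

/-! ## §1 Regrouping a lattice sum into its blocks -/

/-- [folklore] **BLOCK REGROUPING OF AN ABSOLUTELY CONVERGENT LATTICE SUM**: if `Σ_z h z` converges (unconditionally) to `a`, so does the sum over
the blocks `y` of the finite block sums `Σ_{z∈B(y)} h z` (`HasSum.prod_fiberwise` through the chart equivalence `ℤ⁴ ≃ ℤ⁴ × {0,…,m}⁴`). -/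
theorem hasSum_blocks (m : ℕ) {h : X 4 → ℝ} {a : ℝ} (hh : HasSum h a) : HasSum (fun y : X 4 => ∑ z ∈ B m y, h z) a := by
  let e : X 4 × (Fin 4 → Fin (m + 1)) ≃ X 4 :=
    { toFun := fun p => chart m p.1 p.2
      invFun := fun z => (blk m z, locFin m z)
      left_inv := fun p => by
        show (blk m (chart m p.1 p.2), locFin m (chart m p.1 p.2)) = p
        rw [blk_chart, locFin_chart]
      right_inv := fun z => chart_blk_locFin m z }
  have h1 : HasSum (h ∘ e) a := e.hasSum_iff.2 hh
  have h2 : ∀ y : X 4, HasSum (fun c : Fin 4 → Fin (m + 1) => (h ∘ e) (y, c)) (∑ z ∈ B m y, h z) := by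
    intro y
    rw [sum_B]
    exact hasSum_fintype _
  exact h1.prod_fiberwise h2

/-- [folklore] `tsum` form of the block regrouping. -/
theorem tsum_eq_tsum_blocks (m : ℕ) {h : X 4 → ℝ} (hh : Summable h) : ∑' z : X 4, h z = ∑' y : X 4, ∑ z ∈ B m y, h z :=
  ((hasSum_blocks m hh.hasSum).tsum_eq).symm

/-! ## §2 An `n`-free sup bound for the rows of `R∘G′` on the road -/

variable (n : ℕ) [NeZero n] {a : ℝ}

/-- [folklore] ONE BLOCK of the composition `Pgt∘Ggh`: `|Σ_{z∈B(y)} Pgt(x,z)·Ggh(z,s)| ≤ cPPs·(2/min(2,a))·e^{−δ_PP·dist(blk x, y)}` — the `n⁴` sites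
of the block against the sharp `n⁻⁴` projector bound and the uniform bound of the tower propagator. -/
theorem abs_sum_B_Pgt_mul_Ggh_le (ha : 0 < a) (x s y : X 4) :
    |∑ z ∈ B (n - 1) y, Pgt n a x z () () * Ggh n a z s () ()|
      ≤ cPPs 4 a * (2 / min 2 a) * Real.exp (-(deltaPP 4 a * dist (blk (n - 1) x) y)) := by
  have hn : (0 : ℝ) < n := Nat.cast_pos.mpr (Nat.pos_of_ne_zero (NeZero.ne n))
  have hc := const_nonneg (a := a) ha
  have hP := cPPs_nonneg 4 ha
  calc |∑ z ∈ B (n - 1) y, Pgt n a x z () () * Ggh n a z s () ()|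
      ≤ ∑ z ∈ B (n - 1) y, |Pgt n a x z () () * Ggh n a z s () ()| := Finset.abs_sum_le_sum_abs _ _
    _ ≤ ∑ z ∈ B (n - 1) y, cPPs 4 a / (n : ℝ) ^ 4 * Real.exp (-(deltaPP 4 a * dist (blk (n - 1) x) y)) * (2 / min 2 a) := by
        refine Finset.sum_le_sum fun z hz => ?_
        rw [abs_mul]
        have h1 := abs_Pgt_le_sup n ha x z () ()
        rw [mem_B.1 hz] at h1
        have h2 : |Ggh n a z s () ()| ≤ 2 / min 2 a := by
          refine (abs_Ggh_le n a ha z s () ()).trans ?_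
          have : Real.exp (-(B6QGQDecay237.deltaU 4 a * (dist z s / (n : ℝ)))) ≤ 1 := by
            rw [Real.exp_le_one_iff, neg_nonpos]
            exact mul_nonneg (B6QGQDecay237.deltaU_pos 4 ha).le (div_nonneg dist_nonneg hn.le)
          nlinarith
        exact mul_le_mul h1 h2 (abs_nonneg _) (by positivity)
    _ = ((((n - 1 : ℕ) : ℝ) + 1) ^ 4) * (cPPs 4 a / (n : ℝ) ^ 4 * Real.exp (-(deltaPP 4 a * dist (blk (n - 1) x) y)) * (2 / min 2 a)) :=
        sum_B_const y _
    _ = cPPs 4 a * (2 / min 2 a) * Real.exp (-(deltaPP 4 a * dist (blk (n - 1) x) y)) := by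
        rw [cast_pred_add_one n]
        field_simp

/-- [folklore] **`|(Pgt∘Ggh)(x,s)| ≤ cPPs(4,a)·(2/min(2,a))·K₄(δ_PP(4,a))`** — an `n`-FREE sup bound for the entries of the composition (block regrouping +
`RProjector.abs_tsum_le_latticeConst`). -/
theorem abs_comp_Pgt_Ggh_le (ha : 0 < a) (x s : X 4) (v w : Unit) :
    |comp (Pgt n a) (Ggh n a) x s v w| ≤ cPPs 4 a * (2 / min 2 a) * latticeConst 4 (deltaPP 4 a) := by
  obtain ⟨⟩ := v; obtain ⟨⟩ := w
  have hc : comp (Pgt n a) (Ggh n a) x s () () = ∑' z : X 4, Pgt n a x z () () * Ggh n a z s () () := by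
    simp only [comp, Fintype.sum_unique]
  rw [hc, tsum_eq_tsum_blocks (n - 1) (summable_Pgt_mul_Ggh n ha x s)]
  exact abs_tsum_le_latticeConst (deltaPP_pos 4 ha) (mul_nonneg (cPPs_nonneg 4 ha) (const_nonneg (a := a) ha)) (blk (n - 1) x)
    (fun y => abs_sum_B_Pgt_mul_Ggh_le n ha x s y)

/-- [folklore] **THE n-FREE SUP BOUND FOR THE ROWS OF `R∘G′` ON THE ROAD**: `|RG (Ggh n a) (Pgt n a) x s| ≤ 2/min(2,a) + cPPs·(2/min(2,a))·K₄(δ_PP)`. -/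
theorem abs_RG_road_le (ha : 0 < a) (x s : X 4) (v w : Unit) :
    |RG (Ggh n a) (Pgt n a) x s v w| ≤ 2 / min 2 a + cPPs 4 a * (2 / min 2 a) * latticeConst 4 (deltaPP 4 a) := by
  have hn : (0 : ℝ) < n := Nat.cast_pos.mpr (Nat.pos_of_ne_zero (NeZero.ne n))
  show |Ggh n a x s v w - comp (Pgt n a) (Ggh n a) x s v w| ≤ _
  have h1 : |Ggh n a x s v w| ≤ 2 / min 2 a := by
    refine (abs_Ggh_le n a ha x s v w).trans ?_
    have : Real.exp (-(B6QGQDecay237.deltaU 4 a * (dist x s / (n : ℝ)))) ≤ 1 := by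
      rw [Real.exp_le_one_iff, neg_nonpos]
      exact mul_nonneg (B6QGQDecay237.deltaU_pos 4 ha).le (div_nonneg dist_nonneg hn.le)
    have hc := const_nonneg (a := a) ha
    nlinarith
  calc |Ggh n a x s v w - comp (Pgt n a) (Ggh n a) x s v w|
      ≤ |Ggh n a x s v w| + |comp (Pgt n a) (Ggh n a) x s v w| := abs_sub _ _
    _ ≤ _ := add_le_add h1 (abs_comp_Pgt_Ggh_le n ha x s v w)

/-! ## §3 The needle row on the road is `O(n^{κ′−3})` with an `n`-free constant -/

variable (κ' : Fin 4) (u : Site 4)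

/-- [folklore] **THE NEEDLE-ROW LETTER**: `|Σ_{s∈B(blk u)} (R∘G′)(x,s)·qJet n κ′ u (blk u) s| ≤ (2/min(2,a) + cPPs·(2/min(2,a))·K₄(δ_PP))·n^{κ′+1}·n⁻⁴` —
the sup bound of §2 against the needle weight of `AveragingJetNeedle.sum_B_abs_qJet_le` (through `CornerJRankOne.abs_row_le`); the constant does not
depend on the block side `n`. -/
theorem abs_needleRow_road_le (ha : 0 < a) (x : Site 4) (v : Unit) :
    |∑ s ∈ B (n - 1) (blk (n - 1) u), RG (Ggh n a) (Pgt n a) x s v () * qJet n κ' u (blk (n - 1) u) s|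
      ≤ (2 / min 2 a + cPPs 4 a * (2 / min 2 a) * latticeConst 4 (deltaPP 4 a)) * ((n : ℝ) ^ ((κ' : ℕ) + 1) * ((n : ℝ) ^ 4)⁻¹) :=
  abs_row_le n κ' u (Ggh n a) (Pgt n a) x v fun s _ => abs_RG_road_le n ha x s v ()

/-- [folklore] The first-difference letter of the needle row (for the `dSw` entries of the projector sector): twice the row letter. -/
theorem abs_needleRow_diff_road_le (ha : 0 < a) (x x' : Site 4) (v : Unit) :
    |(∑ s ∈ B (n - 1) (blk (n - 1) u), RG (Ggh n a) (Pgt n a) x s v () * qJet n κ' u (blk (n - 1) u) s)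
        - ∑ s ∈ B (n - 1) (blk (n - 1) u), RG (Ggh n a) (Pgt n a) x' s v () * qJet n κ' u (blk (n - 1) u) s|
      ≤ 2 * ((2 / min 2 a + cPPs 4 a * (2 / min 2 a) * latticeConst 4 (deltaPP 4 a)) * ((n : ℝ) ^ ((κ' : ℕ) + 1) * ((n : ℝ) ^ 4)⁻¹)) := by
  have h1 := abs_needleRow_road_le n κ' u ha x v
  have h2 := abs_needleRow_road_le n κ' u ha x' v
  calc _ ≤ |∑ s ∈ B (n - 1) (blk (n - 1) u), RG (Ggh n a) (Pgt n a) x s v () * qJet n κ' u (blk (n - 1) u) s|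
          + |∑ s ∈ B (n - 1) (blk (n - 1) u), RG (Ggh n a) (Pgt n a) x' s v () * qJet n κ' u (blk (n - 1) u) s| := abs_sub _ _
    _ ≤ _ := by linarith

end

end Summit.QuantumFields.BalabanUV.Beta.D1BFx.NeedleRowLetters
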